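import Literature.AnabelianGeometry.SemiGraphs.TemperedMaximalCompactZornTrees
import Literature.AnabelianGeometry.SemiGraphs.TemperedLevelData
import HarnessLib

/-!
# Maximal compact subgroups of `π₁^temp(𝒢)` (Zorn) in `VerticialLevelData` currency

Mochizuki, *Semi-graphs of anabelioids*, Publ. RIMS **42** (2006), §3, Thm. 3.7 (iii)/(iv) pp. 40–41: the level
trees `𝒢_{∞,j}` with the action of `π₁^temp(𝒢)` "that factors through a finite quotient", and the maximal
compact subgroups [cite: MochizukiSemiAnbd2006, Thm 3.7(iv) p.41]; Lemma 1.8 (ii)(a) p. 20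
[cite: MochizukiSemiAnbd2006, Lem. 1.8(ii)(a) p.20].

PROOF-ONLY third part of `TemperedMaximalCompactZorn*.lean` (abc-iut cell, layer L3 frontier programme
«REFUTE-F1732», binder-form support for brick R7 / the (iv) seam of abc-iut-L3-t5's
`not_maximalCompactIffVerticial_of_escaping_of_zorn`; seat abc-iut-w6-d120; no definition).  Over abc-iut-L3-t10's
`ProfiniteSemiGraph.VerticialLevelData D` of a chart `c` (trees `D.tree j`, actions `D.act j : π₁^temp →* Aut 𝒢_{∞,j}`
with open kernels; no definition is introduced):

* `VerticialLevelData.exists_isMaximalCompactSubgroup_ge` — if the kernels `ker (D.act j)` are COFINAL among the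
  neighbourhoods of `1` (binder `hcof`; the canonical chart is the limit of its level groups) and at every level the
  vertex- and edge-stabilisers have images in the level group `π₁^temp ⧸ ker (D.act j)` that are finite of bounded
  order (binder `hbd`; at the countermodel candidate `𝒢_θ`: `≅ G/U_j`, `E/α⁻¹U_j`), then every compact subgroup
  of `π₁^temp(𝒢)` lies in a maximal compact subgroup (= the `hzorn` binder of the (iv) refutation chain);
* `VerticialLevelData.exists_isMaximalCompactSubgroup` (`C = ⊥`).

HONEST FRAMING: nothing here bears on [IUTchIII] Cor. 3.12; no side taken; typed ≠ proved elsewhere.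
-/

namespace Literature.AnabelianGeometry.SemiGraphs

namespace ProfiniteSemiGraph

namespace VerticialLevelData

open Topology
open scoped Pointwise

universe v u

variable {𝒢 : ProfiniteSemiGraph.{u}} {c : TemperedPiChart 𝒢} (D : VerticialLevelData.{v} 𝒢 c)

/-- The stabiliser SET of a tree vertex in the level group `π₁^temp ⧸ ker (act j)` is the image of the stabiliser
set in `π₁^temp`. [cite: MochizukiSemiAnbd2006, Thm 3.7(iii) p.41] -/
private theorem stabilizer_kerLift_vertex_eq (j : D.J) (y : (D.tree j).Vertex) :
    ({γ : c.G ⧸ (D.act j).ker | (QuotientGroup.kerLift (D.act j) γ).hom.vertexMap y = y} :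
        Set (c.G ⧸ (D.act j).ker)) =
      (QuotientGroup.mk : c.G → c.G ⧸ (D.act j).ker) '' {g : c.G | (D.act j g).hom.vertexMap y = y} := by
  ext γ
  constructor
  · intro hγ
    obtain ⟨g, rfl⟩ := QuotientGroup.mk_surjective γ
    exact ⟨g, by simpa [QuotientGroup.kerLift_mk] using hγ, rfl⟩
  · rintro ⟨g, hg, rfl⟩
    simpa [QuotientGroup.kerLift_mk] using hg

/-- The same for edges. [cite: MochizukiSemiAnbd2006, Thm 3.7(iii) p.41] -/
private theorem stabilizer_kerLift_edge_eq (j : D.J) (e : (D.tree j).Edge) :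
    ({γ : c.G ⧸ (D.act j).ker | (QuotientGroup.kerLift (D.act j) γ).hom.edgeMap e = e} :
        Set (c.G ⧸ (D.act j).ker)) =
      (QuotientGroup.mk : c.G → c.G ⧸ (D.act j).ker) '' {g : c.G | (D.act j g).hom.edgeMap e = e} := by
  ext γ
  constructor
  · intro hγ
    obtain ⟨g, rfl⟩ := QuotientGroup.mk_surjective γ
    exact ⟨g, by simpa [QuotientGroup.kerLift_mk] using hγ, rfl⟩
  · rintro ⟨g, hg, rfl⟩
    simpa [QuotientGroup.kerLift_mk] using hg

/-- **Every compact subgroup of `π₁^temp(𝒢)` lies in a maximal compact subgroup — `VerticialLevelData`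
currency.**  Binders: `hcof` — the kernels of the level actions are cofinal among the neighbourhoods of `1`
(the chart is the limit of its level groups); `hbd` — at each level `j` the images in the level group
`π₁^temp ⧸ ker (act j)` of the vertex- and edge-stabilisers are finite of order `≤ B j`.  Then (Zorn over the
tree's compactness criterion, `IsTempered.exists_isMaximalCompactSubgroup_ge_of_treeLevels`; finite subgroups of
the level group fix a vertex or an edge, `lemma_1_8_ii_a_holds`) every compact `C` lies in some maximal compact
`K` — the `hzorn` binder of the (iv) refutation chain at an escaping compact subgroup.
[cite: MochizukiSemiAnbd2006, Thm 3.7(iv) p.41] -/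
theorem exists_isMaximalCompactSubgroup_ge
    (hcof : ∀ U ∈ 𝓝 (1 : c.G), ∃ j : D.J, ((D.act j).ker : Set c.G) ⊆ U)
    (hbd : ∀ j : D.J, ∃ B : ℕ,
      (∀ y : (D.tree j).Vertex,
        ((QuotientGroup.mk : c.G → c.G ⧸ (D.act j).ker) '' {g : c.G | (D.act j g).hom.vertexMap y = y}).Finite ∧
        ((QuotientGroup.mk : c.G → c.G ⧸ (D.act j).ker) '' {g : c.G | (D.act j g).hom.vertexMap y = y}).ncard ≤ B) ∧
      (∀ e : (D.tree j).Edge,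
        ((QuotientGroup.mk : c.G → c.G ⧸ (D.act j).ker) '' {g : c.G | (D.act j g).hom.edgeMap e = e}).Finite ∧
        ((QuotientGroup.mk : c.G → c.G ⧸ (D.act j).ker) '' {g : c.G | (D.act j g).hom.edgeMap e = e}).ncard ≤ B))
    (C : Subgroup c.G) (hC : IsCompact (C : Set c.G)) :
    ∃ K : Subgroup c.G, IsMaximalCompactSubgroup K ∧ C ≤ K := by
  refine c.isTempered.exists_isMaximalCompactSubgroup_ge_of_treeLevels (fun U hU => ?_) C hC
  obtain ⟨j, hj⟩ := hcof U hU
  obtain ⟨B, hv, he⟩ := hbd j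
  -- the open normal kernel of the level-`j` action ("this action factors through a finite quotient")
  refine ⟨⟨⟨(D.act j).ker, D.isOpen_ker j⟩, inferInstance⟩, hj, D.tree j, QuotientGroup.kerLift (D.act j), B,
    D.isTree j, ?_, ?_⟩
  · intro y
    dsimp only
    rw [D.stabilizer_kerLift_vertex_eq j y]
    exact hv y
  · intro e
    dsimp only
    rw [D.stabilizer_kerLift_edge_eq j e]
    exact he e

/-- **Maximal compact subgroups of `π₁^temp(𝒢)` exist** under the same binders (`C = ⊥`).
[cite: MochizukiSemiAnbd2006, Thm 3.7(iv) p.41] -/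
theorem exists_isMaximalCompactSubgroup
    (hcof : ∀ U ∈ 𝓝 (1 : c.G), ∃ j : D.J, ((D.act j).ker : Set c.G) ⊆ U)
    (hbd : ∀ j : D.J, ∃ B : ℕ,
      (∀ y : (D.tree j).Vertex,
        ((QuotientGroup.mk : c.G → c.G ⧸ (D.act j).ker) '' {g : c.G | (D.act j g).hom.vertexMap y = y}).Finite ∧
        ((QuotientGroup.mk : c.G → c.G ⧸ (D.act j).ker) '' {g : c.G | (D.act j g).hom.vertexMap y = y}).ncard ≤ B) ∧
      (∀ e : (D.tree j).Edge,
        ((QuotientGroup.mk : c.G → c.G ⧸ (D.act j).ker) '' {g : c.G | (D.act j g).hom.edgeMap e = e}).Finite ∧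
        ((QuotientGroup.mk : c.G → c.G ⧸ (D.act j).ker) '' {g : c.G | (D.act j g).hom.edgeMap e = e}).ncard ≤ B)) :
    ∃ K : Subgroup c.G, IsMaximalCompactSubgroup K := by
  obtain ⟨K, hK, -⟩ := D.exists_isMaximalCompactSubgroup_ge hcof hbd ⊥
    (by rw [Subgroup.coe_bot]; exact isCompact_singleton)
  exact ⟨K, hK⟩

end VerticialLevelData

end ProfiniteSemiGraph

end Literature.AnabelianGeometry.SemiGraphs
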